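import Summits.QuantumFields.BalabanUV.Beta.MultiscaleGradientMemberCovariant
import Summits.QuantumFields.BalabanUV.Beta.FlatGradientBinderD4

/-!
# `Summit.QuantumFields.BalabanUV.Beta.MultiscaleGradientMemberCovariantD4` — THE d = 4 CLOSER OF THE COVARIANT GRADIENT MEMBER: in Bałaban's
# dimension the flat binder (FG) is a KERNEL THEOREM (co-owner beta-d4-p2's `FlatGradientBinderD4.flatGradient_binder_d4`, p244477, over their
# GR1–GR3 and road P3's `GreenNewtonBoundD4.green_le_inv_dist_pow`), so the gradient member (3.42)₂'s SHAPE for `levelOp` with ARBITRARY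
# column-orthonormal transports holds MODULO (SF) ∧ «σ₁ SMALL» ONLY (file C of road P3's reduction «rough-`Rm` gradient member ⇐ flat interior
# estimate (FG) + sup member + ONE (3.35)-shaped binder (SF)», claim «COVARIANT-FLAT-SPLIT»)

HONEST FRAMING (page 1 of everything in this cell).  Discharging `FlowStep.BetaPertH` would make Bałaban's ultraviolet
stability UNCONDITIONAL — a constructive-QFT result; it is NOT the continuum limit and NOT the Clay problem.  This module
discharges nothing of `BetaPertH`; it is [folklore] finite-dimensional bookkeeping about the MODEL operator, kernel-checked, by CO-OWNER #3
of binder row D4 (unit `b2b-balaban-beta-d4-p3`, road P3 «reduction road», gen 13).  HONEST DEPENDENCY: continuum YM on T⁴ ⇐ BetaPertH ∧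
nine spine estimates (0/9 proved); BetaPertH ⇐ (D1) ∧ (D4) ∧ CAP+tail; G-an2-4 gates asym, D1 and NE2/3/4.

THE POINT.  **`real_grad_levelOp_inverse_le_covariant_d4 (hd : d = 4)`** = file B's `real_grad_levelOp_inverse_le_covariant` with `hFG :=
flatGradient_binder_d4 hcc hc₀`, `K₁ = Kgrad 4`, `K₂ = 9/2·Kgrad 4 + 36·Cdip 4·Cps 4`: for every torus `Π_{μ<4} ℤ/N_μ`, every column-orthonormal
`Rm`, under (SF) (per box at its natural radius: a gauge with deviation `≤ σ₁/(R+1)`, lattice gradient `≤ σ₂/(R+1)²`) and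
`2·4·K₂σ₁√|Cp|·Γe^δ ≤ 1/2`:  `‖(D_R (levelOp)⁻¹u)(b,·)‖ ≤ 2|c₀|√|Cp|·T_cov·n(b₋)·e^{−δ d_n(b₋,t_{k′})}·m`.  So at MODEL level in d = 4 the
ONLY input left for the pointwise gradient member with rough transports is the (3.35)-shaped datum (SF) — the owner's «FALSE without (3.35)»
(E-an4-141d, π-flux witness) and this «TRUE with (3.35)-shape and Mα₀ ≤ a₀» bracket item (i-b) exactly.
WHAT THIS IS NOT: not a bound on Bałaban's ∇_UG′(U); (SF) is a hypothesis SHAPE ((3.35) p. 396 a LOCATOR, not asserted); [B4] Lemma 2.2 NOT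
reproduced; row D4 readiness width 0; D4 DISCHARGE NO DATE.  LOCATORS (shape only; ABSOLUTE RULE): [Balaban1985BackgroundPropagators]
(3.35) p. 396, Thm 3.1 (3.42) p. 397; [Balaban1983RegularityDecay] Lemma 2.2 (2.17) pp. 577–578.  NOT BetaPertH, NOT continuum, NOT Clay,
NOT summit progress.
-/
open scoped BigOperators
open Finset

namespace Summit.QuantumFields.BalabanUV.Beta.MultiscaleGradientMemberCovariantD4

open Summit.QuantumFields.BalabanUV.Beta.BoxPoincare (Box)
open Summit.QuantumFields.BalabanUV.Beta.MultiscaleCoerciveTorus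
open Summit.QuantumFields.BalabanUV.Beta.MultiscaleDistance
open Summit.QuantumFields.BalabanUV.Beta.MultiscaleDistanceMetric (sdist_comm sdist_triangle_torus)
open Summit.QuantumFields.BalabanUV.Beta.MultiscaleDecayBudget
open Summit.QuantumFields.BalabanUV.Beta.MultiscaleDecay (decay_levelOp)
open Summit.QuantumFields.BalabanUV.Beta.AccretiveCombesThomasSandwichSite (sdist_corner_thresholds)
open Summit.QuantumFields.BalabanUV.Beta.MultiscaleBoxDistance (sdist_le_of_dist_le)
open Summit.QuantumFields.BalabanUV.Beta.MultiscaleRegularityClosed (real_sup_levelOp_inverse_le)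
open Summit.QuantumFields.BalabanUV.Beta.MultiscaleGradientSource (abs_le_on_unit_ball abs_levelSum_le_on_unit_ball)
open Summit.QuantumFields.BalabanUV.Beta.SubsolutionMeanValueBox (Cmv Cmv_pos)
open Summit.QuantumFields.BalabanUV.Beta.CovariantKato (sqrt_sum_sq_add_le sqrt_sum_sq_smul sqrt_sum_sq_Rm)
open Summit.QuantumFields.BalabanUV.Beta.CovariantGradientBox (norm_le_sqrt_card_of_abs_le covariant_fdiff_le_box)
open Literature.MathematicalPhysics.QuantumFieldTheory.Balaban1983to89
open Literature.MathematicalPhysics.QuantumFieldTheory.Balaban1983to89.B9Thm37Glue (covD covDT covD_apply covDT_apply)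
open Literature.MathematicalPhysics.QuantumFieldTheory.Balaban1983to89.B9Thm37GluePU (bsrc btgt bsrc_apply btgt_apply)
open Literature.MathematicalPhysics.QuantumFieldTheory.Balaban1983to89.B9Thm37GlueTorusCov (tblk)
open Literature.MathematicalPhysics.QuantumFieldTheory.Balaban1983to89.B9Thm37GlueTorusCovLevels (levelOp levelSum)
open B5TorusCover (UT Ctr ctrU)
open B5Leibniz121 (up dn)



open Summit.QuantumFields.BalabanUV.Beta.MultiscaleGradientMemberCovariant (real_grad_levelOp_inverse_le_covariant)
open Summit.QuantumFields.BalabanUV.Beta.HarmonicGradientInterior (Kgrad)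
open Summit.QuantumFields.BalabanUV.Beta.TorusInversePowerSums (Cps Cps_nonneg)
open Summit.QuantumFields.BalabanUV.Beta.GreenGradientRowSum (Cdip Cdip_nonneg Kgrad_nonneg)
open Summit.QuantumFields.BalabanUV.Beta.FlatGradientBinderD4 (flatGradient_binder_d4)

noncomputable section

variable {d : ℕ} {N : Fin d → ℕ} [∀ i, NeZero (N i)]

section Main


variable [NeZero d] {Cp J K : Type} [Fintype Cp] [DecidableEq Cp] [Nonempty Cp]
  [Fintype J] [Fintype K] [DecidableEq K] (S : J → ℕ) (hS : ∀ l, 1 ≤ S l) (hdivS : ∀ l i, S l ∣ N i) (lvl : K → J)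
  (zc : (k : K) → Ctr N (S (lvl k)))
  (hdisj : ∀ k k' v v', cellPt S hS hdivS lvl zc k v = cellPt S hS hdivS lvl zc k' v' → k = k')
  (hcover : ∀ x : UT N, ∃ k, ∃ v : Box d (S (lvl k)), cellPt S hS hdivS lvl zc k v = x)
  (Rm : UT N × Fin d → Cp → Cp → ℝ) (hRm : ∀ b i j, ∑ k, Rm b k i * Rm b k j = if i = j then (1 : ℝ) else 0)
  (T : J → UT N → Cp → Cp → ℝ) (hT : ∀ l x i i', ∑ k, T l x k i * T l x k i' = if i = i' then (1 : ℝ) else 0)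
  (a : J → ℝ) (ha : ∀ j, 0 ≤ a j) (ω : J → UT N → ℝ)
  (hsupp : ∀ l x, ω l (ctrU N (S l) (tblk (hS l) (hdivS l) x)) ≠ 0 → ∃ k v, lvl k = l ∧ cellPt S hS hdivS lvl zc k v = x)
  {amax : ℝ} (hamax : 0 ≤ amax)
  (hscale : ∀ k, a (lvl k) * ω (lvl k) (ctrU N (S (lvl k)) (zc k)) ^ 2 * (S (lvl k) : ℝ) ^ d ≤ amax / (S (lvl k) : ℝ) ^ 2)
  (c : UT N × Fin d → ℝ) {c₀ : ℝ} (hcc : ∀ b, c b = c₀) (hc₀ : c₀ ≠ 0)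
  {L : ℕ} (hL : 1 ≤ L) (e : J → ℕ) (hSe : ∀ l, S l = L ^ e l) {R : ℝ} (hR : 0 < R) {A : ℕ}
  (hadd : ∀ x y : UT N, |(e (lvl (cellOf S hS hdivS lvl zc hcover x)) : ℝ) - e (lvl (cellOf S hS hdivS lvl zc hcover y))| ≤
    A + sdist bsrc btgt (siteScale S hS hdivS lvl zc hcover) x y / R)

include hdisj hT ha hsupp hamax hscale hL e hSe hR hadd hRm hcc hc₀

/-- **THE COVARIANT GRADIENT MEMBER FOR `levelOp` IN d = 4, MODULO (SF) ∧ «σ₁ SMALL» ONLY** — file B with the flat binder DISCHARGED by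
co-owner beta-d4-p2's `flatGradient_binder_d4` (`K₁ = Kgrad 4`, `K₂ = 9/2·Kgrad 4 + 36·Cdip 4·Cps 4`).  (SF) is a HYPOTHESIS (ABSOLUTE RULE);
NOT a bound on Bałaban's ∇_UG′(U). [cite: Balaban1985BackgroundPropagators, Thm 3.1 (3.42) p.397 + (3.35) p.396] [folklore] -/
theorem real_grad_levelOp_inverse_le_covariant_d4 (hd : d = 4) {cmax : ℝ} (hc : ∀ b, |c b| ≤ cmax) {C : ℝ}
    (hcoer : ∀ f : UT N × Cp → ℝ,
      C * ∑ k, ((S (lvl k) : ℝ) ^ 2)⁻¹ * ∑ v : Box d (S (lvl k)), ∑ i, f (cellPt S hS hdivS lvl zc k v, i) ^ 2 ≤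
        ∑ p, f p * levelOp bsrc btgt c Rm (fun l x => ctrU N (S l) (tblk (hS l) (hdivS l) x))
          (fun l x => ω l (ctrU N (S l) (tblk (hS l) (hdivS l) x))) T a f p)
    {κ : ℝ} (hκ0 : 0 ≤ κ) (hκ1 : κ ≤ 1) (hμ : 0 < C - 2 * d * cmax ^ 2 * κ ^ 2 - amax * (Real.exp (2 * d * κ) - 1))
    (hrate : (1 + d / 2) * (Real.log L / R) ≤ κ)
    {Γ θ δ 𝔅 : ℝ} (hΓ : Γ = (L : ℝ) ^ A * Real.exp (Real.log L / R * (4 * d + 1))) (hθ : θ = 1 / (4 * d * Γ))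
    (hδ : δ = κ - (1 + d / 2) * (Real.log L / R))
    (h𝔅 : 𝔅 = (max (Real.sqrt (11 ^ d)) (Cmv d * Real.sqrt (21 ^ d)) / Real.sqrt (θ ^ d) +
            Real.sqrt (Fintype.card Cp) * (θ + 1) ^ 2 * (amax * Γ ^ 2 * Real.sqrt (Γ ^ d)) / (2 * c₀ ^ 2)) *
          (Real.sqrt (Fintype.card Cp) * Real.exp (κ * ((4 * d + 1) + 2 * d)) *
            ((L : ℝ) ^ A * Real.exp (Real.log L / R * (4 * d + 1))) * (L : ℝ) ^ A * Real.sqrt (((L : ℝ) ^ A) ^ d) /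
            (C - 2 * d * cmax ^ 2 * κ ^ 2 - amax * (Real.exp (2 * d * κ) - 1))) +
          Real.sqrt (Fintype.card Cp) * (θ + 1) ^ 2 / (2 * c₀ ^ 2) *
            Real.exp ((κ - (1 + d / 2) * (Real.log L / R)) * ((4 * d + 1) + 2 * d)))
    {σ₁ σ₂ : ℝ} (hσ₁ : 0 ≤ σ₁) (hσ₂ : 0 ≤ σ₂)
    (hSF : ∀ (x₀ : UT N) (R : ℕ), 1 ≤ R → (R : ℝ) ≤ (siteScale S hS hdivS lvl zc hcover x₀ : ℝ) * θ / 4 →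
      (siteScale S hS hdivS lvl zc hcover x₀ : ℝ) * θ / 4 < R + 1 → ∃ g : UT N → Cp → Cp → ℝ, ∃ Rg : UT N × Fin d → Cp → Cp → ℝ,
      (∀ x i j, ∑ k, g x k i * g x k j = if i = j then (1 : ℝ) else 0) ∧
      (∀ b i j, Rg b i j = ∑ k, g (bsrc b) i k * ∑ l, Rm b k l * g (btgt b) j l) ∧
      (∀ b : UT N × Fin d, dist (bsrc b) x₀ ≤ 2 * R + 3 → ∀ v : Cp → ℝ,
        Real.sqrt (∑ i, (∑ j, (Rg b i j - if i = j then (1 : ℝ) else 0) * v j) ^ 2) ≤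
          σ₁ / ((R : ℝ) + 1) * Real.sqrt (∑ j, v j ^ 2)) ∧
      (∀ x ∈ univ.filter (fun x : UT N => dist x x₀ ≤ 2 * R + 2), ∀ μ (v : Cp → ℝ),
        Real.sqrt (∑ i, (∑ j, (Rg (dn x μ, μ) i j - Rg (x, μ) i j) * v j) ^ 2) ≤
          σ₂ / ((R : ℝ) + 1) ^ 2 * Real.sqrt (∑ j, v j ^ 2)))
    (hsmall : 2 * d * (9 / 2 * Kgrad 4 + 36 * Cdip 4 * Cps 4) * σ₁ * Real.sqrt (Fintype.card Cp) * (Γ * Real.exp δ) ≤ 1 / 2)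
    (k' : K) (u : UT N × Cp → ℝ) (hu : ∀ p, cellOf S hS hdivS lvl zc hcover p.1 ≠ k' → u p = 0)
    {m : ℝ} (hm : 0 ≤ m) (hum : ∀ p, |u p| ≤ m) (b : UT N × Fin d) :
    Real.sqrt (∑ i, covD bsrc btgt c Rm ((Ring.inverse (levelOp bsrc btgt c Rm (fun l x => ctrU N (S l) (tblk (hS l) (hdivS l) x))
        (fun l x => ω l (ctrU N (S l) (tblk (hS l) (hdivS l) x))) T a)) u) (b, i) ^ 2) ≤
      2 * (|c₀| * Real.sqrt (Fintype.card Cp) *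
          (𝔅 * (Γ ^ 2 * Real.exp δ + 1) * (16 * d * Γ) + Real.sqrt (Fintype.card Cp) * Kgrad 4 * 𝔅 * Γ ^ 2 * Real.exp δ * (16 * d * Γ) +
            Real.sqrt (Fintype.card Cp) * (9 / 2 * Kgrad 4 + 36 * Cdip 4 * Cps 4) * (θ / 4 + 1) *
              (Real.exp (δ * (2 * d + 1)) + amax * Real.sqrt (Fintype.card Cp) * 𝔅 * Real.exp (δ * (4 * d + 1))) / c₀ ^ 2 +
            Real.sqrt (Fintype.card Cp) * (9 / 2 * Kgrad 4 + 36 * Cdip 4 * Cps 4) * (d * (σ₂ + σ₁ ^ 2)) * 𝔅 * Γ ^ 2 * Real.exp δ * (16 * d * Γ) +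
            σ₁ * 𝔅 * Γ ^ 2 * Real.exp δ * (16 * d * Γ))) *
        (siteScale S hS hdivS lvl zc hcover (bsrc b) : ℝ) *
        Real.exp (-(δ * sdist bsrc btgt (siteScale S hS hdivS lvl zc hcover) (bsrc b) (ctrU N (S (lvl k')) (zc k')))) * m := by
  subst hd
  have hK₂ : (0 : ℝ) ≤ 9 / 2 * Kgrad 4 + 36 * Cdip 4 * Cps 4 := by
    have h1 : 0 ≤ Kgrad 4 := Kgrad_nonneg (by norm_num)
    have h2 : 0 ≤ Cdip 4 := Cdip_nonneg (by norm_num)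
    have h3 : 0 ≤ Cps 4 := Cps_nonneg 4
    positivity
  exact real_grad_levelOp_inverse_le_covariant S hS hdivS lvl zc hdisj hcover Rm hRm T hT a ha ω hsupp hamax hscale c hcc hc₀ hL e hSe
    hR hadd hc hcoer hκ0 hκ1 hμ hrate hΓ hθ hδ h𝔅 (Kgrad_nonneg (by norm_num)) hK₂ (flatGradient_binder_d4 hcc hc₀) hσ₁ hσ₂ hSF hsmall
    k' u hu hm hum b

end Main

end

end Summit.QuantumFields.BalabanUV.Beta.MultiscaleGradientMemberCovariantD4
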